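import Summits.CriticalPhenomena.PercolationContinuityZ3.Theorems.PercNearOneGluingNoHeavyLowerTailSunflowerOnePointCertificatesB
import HarnessLib

/-!
# `NoHeavyLowerTail` (crux stmt-CriticalPhenomena-4575), abstract sunflower cubic: the two remaining (asymmetric) maximal ONE-POINT CERTIFICATE
# classes — a missing lower petal with no exits, and no entries with a completed petal

Support file (seat `prim-ineq-gen-2` gen 24; `--supports stmt-CriticalPhenomena-4575`; companion of `…SunflowerOnePointCertificates` (p332425) and
`…SunflowerOnePointCertificatesB`).  Memo: run/shared/lean/prim/prim-ineq-gen-2/ONE-POINT-SCAN-GEN24.md §2, classes (6) and (9).  Nothing is asserted about the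
crux; no `sorry`.

SETTING.  As in the companions: `e ∉ W`, lower section `φ = lab`, upper section `ψ = lab (insert e ·)` on `2^W`, `b₀ = F.ZP W ∅ ∅ ∅`, `3b₁ = F.ZP (insert e W) ∅ ∅ ∅`,
`b₃ = (F.con e).ZP W ∅ ∅ ∅`.  With this file every one of the 11 petal-orbits of maximal one-point classes with an inductive pointwise certificate (memo §2) is
either a tree mechanism of `…SunflowerGoodCoordinate` / `…RestrictionTwoPetal` / `…RestrictionExchange` or a theorem of this three-file series.

* `Sunflower.ZP_add_con_le_of_missing_petal_no_exit` — class (6): if the lower section misses the petal value `k` (`lab X ≠ k` on `2^W`) and no lower petal set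
  exits (`lab X ∈ {1,2,3} → lab (insert e X) = lab X`), then `b₀ + b₃ ≤ 3b₁`.  (The upper section may enter all three petals, so lifted rainbows and same-direction
  entries occur and `lab {e}` may be `0`: not covered by (A)/(NLR)/(H*)/upper-one-petal.)
* `Sunflower.two_ZP_le_of_no_entry_completed_petal` — class (9): if no bottom set enters a petal (`lab X = 0 → lab (insert e X) ∈ {0, ⊤}`) and every lower petal-`k`
  set exits (`lab X = k → lab (insert e X) = ⊤`), then `2b₀ ≤ 3b₁` (the other two petals may stay or exit freely).
Both kernels are pointwise nonnegative after symmetrisation (`decide` over `5⁷` tuples, the petal value `k` being a variable), the Gladkov weights are `3`.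
-/

namespace Summit.CriticalPhenomena.PercolationContinuityZ3.Theorems.SunflowerPartition

open Finset

/-! ## Code kernels -/

/-- Class (6) kernel: `3·s6H x₁ y₀ z₀ − s6H x₀ y₀ z₀ − s6H x₁ y₁ z₁ − 3[code (0,0) or (⊤,⊤)]·kk y₀ z₀ − 3[(0,⊤)]·kk y₁ z₀ − 3[entry]·kk y₁ z₁`. [this work] -/
def mpKernel (x0 x1 y0 y1 z0 z1 : Fin 5) : ℤ :=
  3 * s6H x1 y0 z0 - s6H x0 y0 z0 - s6H x1 y1 z1
    - (if (x0 = 0 ∧ x1 = 0) ∨ (x0 = 4 ∧ x1 = 4) then (3 : ℤ) else 0) * kk y0 z0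
    - (if x0 = 0 ∧ x1 = 4 then (3 : ℤ) else 0) * kk y1 z0
    - (if x0 = 0 ∧ (x1 = 1 ∨ x1 = 2 ∨ x1 = 3) then (3 : ℤ) else 0) * kk y1 z1

/-- Symmetrisation of `mpKernel`. [this work] -/
def mpSymm (x0 x1 y0 y1 z0 z1 : Fin 5) : ℤ :=
  mpKernel x0 x1 y0 y1 z0 z1 + mpKernel x0 x1 z0 z1 y0 y1 + mpKernel y0 y1 x0 x1 z0 z1
    + mpKernel y0 y1 z0 z1 x0 x1 + mpKernel z0 z1 x0 x1 y0 y1 + mpKernel z0 z1 y0 y1 x0 x1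

/-- Class (6) code test with missing petal `k`: `x₀ ≤ x₁`, `x₀ ≠ k`, and `x₀ ∈ {1,2,3} → x₁ = x₀`. [this work] -/
def mpCode (k x0 x1 : Fin 5) : Bool := (x0 = x1 || x0 = 0 || x1 = 4) && !(x0 = k) && (!(x0 = 1 || x0 = 2 || x0 = 3) || x1 = x0)

/-- Conditions to code test. [this work] -/
theorem mpCode_of_conds : ∀ k x0 x1 : Fin 5, (x0 = x1 ∨ x0 = 0 ∨ x1 = 4) → x0 ≠ k → (x0 ≠ 0 → x0 ≠ 4 → x1 = x0) → mpCode k x0 x1 = true := by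
  decide

/-- Pointwise nonnegativity of the symmetrised class-(6) kernel (`k` a petal value). [this work] -/
theorem mpSymm_nonneg_code : ∀ k x0 x1 y0 y1 z0 z1 : Fin 5, (k = 1 ∨ k = 2 ∨ k = 3) →
    mpCode k x0 x1 = true → mpCode k y0 y1 = true → mpCode k z0 z1 = true → 0 ≤ mpSymm x0 x1 y0 y1 z0 z1 := by
  decide

/-- Class (9) kernel: `3·s6H x₁ y₀ z₀ − 2·s6H x₀ y₀ z₀ − 3[(0,0) or (⊤,⊤)]·kk y₁ z₁ − 3[(0,⊤)]·kk y₁ z₀ − 3[exit]·kk y₀ z₀`. [this work] -/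
def neKernel (x0 x1 y0 y1 z0 z1 : Fin 5) : ℤ :=
  3 * s6H x1 y0 z0 - 2 * s6H x0 y0 z0
    - (if (x0 = 0 ∧ x1 = 0) ∨ (x0 = 4 ∧ x1 = 4) then (3 : ℤ) else 0) * kk y1 z1
    - (if x0 = 0 ∧ x1 = 4 then (3 : ℤ) else 0) * kk y1 z0
    - (if (x0 = 1 ∨ x0 = 2 ∨ x0 = 3) ∧ x1 = 4 then (3 : ℤ) else 0) * kk y0 z0

/-- Symmetrisation of `neKernel`. [this work] -/
def neSymm (x0 x1 y0 y1 z0 z1 : Fin 5) : ℤ :=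
  neKernel x0 x1 y0 y1 z0 z1 + neKernel x0 x1 z0 z1 y0 y1 + neKernel y0 y1 x0 x1 z0 z1
    + neKernel y0 y1 z0 z1 x0 x1 + neKernel z0 z1 x0 x1 y0 y1 + neKernel z0 z1 y0 y1 x0 x1

/-- Class (9) code test with completed petal `k`: `x₀ ≤ x₁`, `x₀ = 0 → x₁ ∈ {0,⊤}`, `x₀ = k → x₁ = ⊤`. [this work] -/
def neCode (k x0 x1 : Fin 5) : Bool := (x0 = x1 || x0 = 0 || x1 = 4) && (!(x0 = 0) || x1 = 0 || x1 = 4) && (!(x0 = k) || x1 = 4)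

/-- Conditions to code test. [this work] -/
theorem neCode_of_conds : ∀ k x0 x1 : Fin 5, (x0 = x1 ∨ x0 = 0 ∨ x1 = 4) → (x0 = 0 → (x1 = 0 ∨ x1 = 4)) → (x0 = k → x1 = 4) → neCode k x0 x1 = true := by
  decide

/-- Pointwise nonnegativity of the symmetrised class-(9) kernel (`k` a petal value). [this work] -/
theorem neSymm_nonneg_code : ∀ k x0 x1 y0 y1 z0 z1 : Fin 5, (k = 1 ∨ k = 2 ∨ k = 3) →
    neCode k x0 x1 = true → neCode k y0 y1 = true → neCode k z0 z1 = true → 0 ≤ neSymm x0 x1 y0 y1 z0 z1 := by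
  decide

variable {α : Type*} [DecidableEq α]

namespace Sunflower

variable (F : Sunflower α)

/-! ## Class (6): a missing lower petal and no exits -/

/-- **Class (6), nested form** (this work). -/
theorem nested_missing_petal_no_exit_le (W : Finset α) (e : α) (k : Fin 5) (hk : k = 1 ∨ k = 2 ∨ k = 3)
    (hmiss : ∀ X, X ⊆ W → F.lab X ≠ k) (hstay : ∀ X, X ⊆ W → F.lab X ≠ 0 → F.lab X ≠ 4 → F.lab (insert e X) = F.lab X) :
    nested W (fun X S T => s6H (F.lab X) (F.lab S) (F.lab T))
      + nested W (fun X S T => s6H (F.lab (insert e X)) (F.lab (insert e S)) (F.lab (insert e T)))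
      + nested W (fun X S T => (if (F.lab X = 0 ∧ F.lab (insert e X) = 0) ∨ (F.lab X = 4 ∧ F.lab (insert e X) = 4) then (3 : ℤ) else 0) * kk (F.lab S) (F.lab T))
      + nested W (fun X S T => (if F.lab X = 0 ∧ F.lab (insert e X) = 4 then (3 : ℤ) else 0) * kk (F.lab (insert e S)) (F.lab T))
      + nested W (fun X S T => (if F.lab X = 0 ∧ (F.lab (insert e X) = 1 ∨ F.lab (insert e X) = 2 ∨ F.lab (insert e X) = 3) then (3 : ℤ) else 0)
          * kk (F.lab (insert e S)) (F.lab (insert e T)))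
      ≤ 3 * nested W (fun X S T => s6H (F.lab (insert e X)) (F.lab S) (F.lab T)) := by
  have hdiff : 3 * nested W (fun X S T => s6H (F.lab (insert e X)) (F.lab S) (F.lab T))
      - nested W (fun X S T => s6H (F.lab X) (F.lab S) (F.lab T))
      - nested W (fun X S T => s6H (F.lab (insert e X)) (F.lab (insert e S)) (F.lab (insert e T)))
      - nested W (fun X S T => (if (F.lab X = 0 ∧ F.lab (insert e X) = 0) ∨ (F.lab X = 4 ∧ F.lab (insert e X) = 4) then (3 : ℤ) else 0) * kk (F.lab S) (F.lab T))
      - nested W (fun X S T => (if F.lab X = 0 ∧ F.lab (insert e X) = 4 then (3 : ℤ) else 0) * kk (F.lab (insert e S)) (F.lab T))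
      - nested W (fun X S T => (if F.lab X = 0 ∧ (F.lab (insert e X) = 1 ∨ F.lab (insert e X) = 2 ∨ F.lab (insert e X) = 3) then (3 : ℤ) else 0)
          * kk (F.lab (insert e S)) (F.lab (insert e T)))
      = nested W (fun X S T => mpKernel (F.lab X) (F.lab (insert e X)) (F.lab S) (F.lab (insert e S)) (F.lab T) (F.lab (insert e T))) := by
    unfold nested mpKernel
    simp only [mul_sum, ← sum_sub_distrib]
  have hsym := six_mul_nested_codes_eq W F.lab (fun X => F.lab (insert e X)) mpKernel
  have hpos : 0 ≤ nested W (fun X S T =>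
      mpKernel (F.lab X) (F.lab (insert e X)) (F.lab S) (F.lab (insert e S)) (F.lab T) (F.lab (insert e T))
        + mpKernel (F.lab X) (F.lab (insert e X)) (F.lab T) (F.lab (insert e T)) (F.lab S) (F.lab (insert e S))
        + mpKernel (F.lab S) (F.lab (insert e S)) (F.lab X) (F.lab (insert e X)) (F.lab T) (F.lab (insert e T))
        + mpKernel (F.lab S) (F.lab (insert e S)) (F.lab T) (F.lab (insert e T)) (F.lab X) (F.lab (insert e X))
        + mpKernel (F.lab T) (F.lab (insert e T)) (F.lab X) (F.lab (insert e X)) (F.lab S) (F.lab (insert e S))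
        + mpKernel (F.lab T) (F.lab (insert e T)) (F.lab S) (F.lab (insert e S)) (F.lab X) (F.lab (insert e X))) := by
    unfold nested
    refine sum_nonneg fun X hX => sum_nonneg fun S hS => ?_
    have hXW : X ⊆ W := mem_powerset.1 hX
    have hSW : S ⊆ W := (mem_powerset.1 hS).trans sdiff_subset
    have hTW : (W \ X) \ S ⊆ W := sdiff_subset.trans sdiff_subset
    exact mpSymm_nonneg_code k _ _ _ _ _ _ hk
      (mpCode_of_conds k _ _ (F.lab_mono (subset_insert e X)) (hmiss X hXW) (hstay X hXW))
      (mpCode_of_conds k _ _ (F.lab_mono (subset_insert e S)) (hmiss S hSW) (hstay S hSW))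
      (mpCode_of_conds k _ _ (F.lab_mono (subset_insert e _)) (hmiss _ hTW) (hstay _ hTW))
  have h6 : 0 ≤ 6 * nested W (fun X S T =>
      mpKernel (F.lab X) (F.lab (insert e X)) (F.lab S) (F.lab (insert e S)) (F.lab T) (F.lab (insert e T))) := by
    rw [hsym]; exact hpos
  linarith

/-- **Spectator Gladkov, mixed polarisation** (this work): for nonnegative code weights `a`,
`0 ≤ Σ_X a(lab X, lab (insert e X)) · Σ_{S ⊆ W∖X} kk (lab (insert e S)) (lab ((W∖X)∖S))` (polarised antipodal Gladkov with offsets `{e} ⊇ ∅`). -/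
theorem spectator_mixed_gladkov_nonneg (W : Finset α) (e : α) (a : Fin 5 → Fin 5 → ℤ) (ha : ∀ x y, 0 ≤ a x y) :
    0 ≤ nested W (fun X S T => a (F.lab X) (F.lab (insert e X)) * kk (F.lab (insert e S)) (F.lab T)) := by
  unfold nested
  refine sum_nonneg fun X _ => ?_
  rw [← mul_sum]
  refine mul_nonneg (ha _ _) ?_
  have h := F.antipodal_gladkov_polarized (W \ X) {e} ∅ (empty_subset _)
  refine le_of_le_of_eq h (sum_congr rfl fun S _ => ?_)
  rw [← insert_eq, empty_union]

/-- **Class (6)** (this work): `e ∉ W`, the lower section on `2^W` misses the petal value `k` and none of its petal sets exits under `e` ⟹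
`F.ZP W ∅ ∅ ∅ + (F.con e).ZP W ∅ ∅ ∅ ≤ F.ZP (insert e W) ∅ ∅ ∅` (`b₀ + b₃ ≤ 3b₁`). -/
theorem ZP_add_con_le_of_missing_petal_no_exit {β : Type*} [Fintype β] [DecidableEq β] (F : Sunflower β) (W : Finset β) (e : β) (he : e ∉ W)
    (k : Fin 5) (hk : k = 1 ∨ k = 2 ∨ k = 3) (hmiss : ∀ X, X ⊆ W → F.lab X ≠ k)
    (hstay : ∀ X, X ⊆ W → F.lab X ≠ 0 → F.lab X ≠ 4 → F.lab (insert e X) = F.lab X) :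
    F.ZP W ∅ ∅ ∅ + (F.con e).ZP W ∅ ∅ ∅ ≤ F.ZP (insert e W) ∅ ∅ ∅ := by
  rw [F.con_ZP_eq, ← F.nested_con_eq_ZP, F.ZP_empty_eq_nested, F.ZP_empty_eq_nested, F.nested_insert_eq W e he]
  have h1 := F.nested_missing_petal_no_exit_le W e k hk hmiss hstay
  have h3 : 0 ≤ nested W (fun X S T => (if (F.lab X = 0 ∧ F.lab (insert e X) = 0) ∨ (F.lab X = 4 ∧ F.lab (insert e X) = 4) then (3 : ℤ) else 0)
      * kk (F.lab S) (F.lab T)) := by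
    unfold nested
    refine sum_nonneg fun X _ => ?_
    rw [← mul_sum]
    exact mul_nonneg (by split_ifs <;> norm_num) (F.antipodal_gladkov (W \ X))
  have h4 := F.spectator_mixed_gladkov_nonneg W e (fun x y => if x = 0 ∧ y = 4 then (3 : ℤ) else 0) (fun x y => by split_ifs <;> norm_num)
  have h5 := F.spectator_con_gladkov_nonneg W e (fun x y => if x = 0 ∧ (y = 1 ∨ y = 2 ∨ y = 3) then (3 : ℤ) else 0)
    (fun x y => by split_ifs <;> norm_num)
  linarith

/-! ## Class (9): no entries and a completed petal -/

/-- **Class (9), nested form** (this work). -/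
theorem nested_no_entry_completed_petal_le (W : Finset α) (e : α) (k : Fin 5) (hk : k = 1 ∨ k = 2 ∨ k = 3)
    (hne : ∀ X, X ⊆ W → F.lab X = 0 → (F.lab (insert e X) = 0 ∨ F.lab (insert e X) = 4))
    (hexit : ∀ X, X ⊆ W → F.lab X = k → F.lab (insert e X) = 4) :
    2 * nested W (fun X S T => s6H (F.lab X) (F.lab S) (F.lab T))
      + nested W (fun X S T => (if (F.lab X = 0 ∧ F.lab (insert e X) = 0) ∨ (F.lab X = 4 ∧ F.lab (insert e X) = 4) then (3 : ℤ) else 0)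
          * kk (F.lab (insert e S)) (F.lab (insert e T)))
      + nested W (fun X S T => (if F.lab X = 0 ∧ F.lab (insert e X) = 4 then (3 : ℤ) else 0) * kk (F.lab (insert e S)) (F.lab T))
      + nested W (fun X S T => (if (F.lab X = 1 ∨ F.lab X = 2 ∨ F.lab X = 3) ∧ F.lab (insert e X) = 4 then (3 : ℤ) else 0) * kk (F.lab S) (F.lab T))
      ≤ 3 * nested W (fun X S T => s6H (F.lab (insert e X)) (F.lab S) (F.lab T)) := by
  have hdiff : 3 * nested W (fun X S T => s6H (F.lab (insert e X)) (F.lab S) (F.lab T))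
      - 2 * nested W (fun X S T => s6H (F.lab X) (F.lab S) (F.lab T))
      - nested W (fun X S T => (if (F.lab X = 0 ∧ F.lab (insert e X) = 0) ∨ (F.lab X = 4 ∧ F.lab (insert e X) = 4) then (3 : ℤ) else 0)
          * kk (F.lab (insert e S)) (F.lab (insert e T)))
      - nested W (fun X S T => (if F.lab X = 0 ∧ F.lab (insert e X) = 4 then (3 : ℤ) else 0) * kk (F.lab (insert e S)) (F.lab T))
      - nested W (fun X S T => (if (F.lab X = 1 ∨ F.lab X = 2 ∨ F.lab X = 3) ∧ F.lab (insert e X) = 4 then (3 : ℤ) else 0) * kk (F.lab S) (F.lab T))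
      = nested W (fun X S T => neKernel (F.lab X) (F.lab (insert e X)) (F.lab S) (F.lab (insert e S)) (F.lab T) (F.lab (insert e T))) := by
    unfold nested neKernel
    simp only [mul_sum, ← sum_sub_distrib]
  have hsym := six_mul_nested_codes_eq W F.lab (fun X => F.lab (insert e X)) neKernel
  have hpos : 0 ≤ nested W (fun X S T =>
      neKernel (F.lab X) (F.lab (insert e X)) (F.lab S) (F.lab (insert e S)) (F.lab T) (F.lab (insert e T))
        + neKernel (F.lab X) (F.lab (insert e X)) (F.lab T) (F.lab (insert e T)) (F.lab S) (F.lab (insert e S))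
        + neKernel (F.lab S) (F.lab (insert e S)) (F.lab X) (F.lab (insert e X)) (F.lab T) (F.lab (insert e T))
        + neKernel (F.lab S) (F.lab (insert e S)) (F.lab T) (F.lab (insert e T)) (F.lab X) (F.lab (insert e X))
        + neKernel (F.lab T) (F.lab (insert e T)) (F.lab X) (F.lab (insert e X)) (F.lab S) (F.lab (insert e S))
        + neKernel (F.lab T) (F.lab (insert e T)) (F.lab S) (F.lab (insert e S)) (F.lab X) (F.lab (insert e X))) := by
    unfold nested
    refine sum_nonneg fun X hX => sum_nonneg fun S hS => ?_
    have hXW : X ⊆ W := mem_powerset.1 hX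
    have hSW : S ⊆ W := (mem_powerset.1 hS).trans sdiff_subset
    have hTW : (W \ X) \ S ⊆ W := sdiff_subset.trans sdiff_subset
    exact neSymm_nonneg_code k _ _ _ _ _ _ hk
      (neCode_of_conds k _ _ (F.lab_mono (subset_insert e X)) (hne X hXW) (hexit X hXW))
      (neCode_of_conds k _ _ (F.lab_mono (subset_insert e S)) (hne S hSW) (hexit S hSW))
      (neCode_of_conds k _ _ (F.lab_mono (subset_insert e _)) (hne _ hTW) (hexit _ hTW))
  have h6 : 0 ≤ 6 * nested W (fun X S T =>
      neKernel (F.lab X) (F.lab (insert e X)) (F.lab S) (F.lab (insert e S)) (F.lab T) (F.lab (insert e T))) := by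
    rw [hsym]; exact hpos
  linarith

/-- **Class (9)** (this work): `e ∉ W`, no bottom set of `2^W` enters a petal under `e`, and every lower petal-`k` set exits to `⊤` ⟹
`2 · F.ZP W ∅ ∅ ∅ ≤ F.ZP (insert e W) ∅ ∅ ∅` (`2b₀ ≤ 3b₁`; in particular (MZ) at `e` when `0 ≤ F.ZP W ∅ ∅ ∅`). -/
theorem two_ZP_le_of_no_entry_completed_petal (W : Finset α) (e : α) (he : e ∉ W) (k : Fin 5) (hk : k = 1 ∨ k = 2 ∨ k = 3)
    (hne : ∀ X, X ⊆ W → F.lab X = 0 → (F.lab (insert e X) = 0 ∨ F.lab (insert e X) = 4))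
    (hexit : ∀ X, X ⊆ W → F.lab X = k → F.lab (insert e X) = 4) :
    2 * F.ZP W ∅ ∅ ∅ ≤ F.ZP (insert e W) ∅ ∅ ∅ := by
  rw [F.ZP_empty_eq_nested, F.ZP_empty_eq_nested, F.nested_insert_eq W e he]
  have h1 := F.nested_no_entry_completed_petal_le W e k hk hne hexit
  have h3 := F.spectator_con_gladkov_nonneg W e
    (fun x y => if (x = 0 ∧ y = 0) ∨ (x = 4 ∧ y = 4) then (3 : ℤ) else 0) (fun x y => by split_ifs <;> norm_num)
  have h4 := F.spectator_mixed_gladkov_nonneg W e (fun x y => if x = 0 ∧ y = 4 then (3 : ℤ) else 0) (fun x y => by split_ifs <;> norm_num)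
  have h5 : 0 ≤ nested W (fun X S T => (if (F.lab X = 1 ∨ F.lab X = 2 ∨ F.lab X = 3) ∧ F.lab (insert e X) = 4 then (3 : ℤ) else 0)
      * kk (F.lab S) (F.lab T)) := by
    unfold nested
    refine sum_nonneg fun X _ => ?_
    rw [← mul_sum]
    exact mul_nonneg (by split_ifs <;> norm_num) (F.antipodal_gladkov (W \ X))
  linarith

end Sunflower

end Summit.CriticalPhenomena.PercolationContinuityZ3.Theorems.SunflowerPartition
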